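import Literature.NumberTheory.Automorphic.HyperspecialUnitaryCartan
import Literature.NumberTheory.Automorphic.UnitaryGroupSplitPlace
import Literature.NumberTheory.Automorphic.QuadraticLocalBaseChange
import Literature.NumberTheory.Automorphic.Liu2021.LemD1AsPrintedIndexedNonVacuityInertCofinite
import Literature.RingTheory.DiscreteValuationRing.AdicCompletionHensel
import Literature.NumberTheory.Automorphic.UnitaryGroupInertPlaceHyperbolicBasisDyadic
import HarnessLib

/-!
# Cartan decomposition of `U(σ_w, J₀)(E_w)` at a non-split, unramified, non-dyadic place (Tits 1979 §3.3.3)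

Topic `NumberTheory/Automorphic`; namespace `Literature.NumberTheory.Automorphic.UnitaryGroup`.
THEOREMS only; no definition, no named fact, no `sorry`.

For a quadratic extension of number fields `E/F` with non-trivial automorphism `c`, a finite place `v` of `F`
UNRAMIFIED in `E` with `v ∤ 2`, and a place `w ∣ v` of `E` fixed by `c` (so `v` is inert), the completion `E_w` with
the local conjugation `σ_w = galAdicCompletionMap c hw` carries the datum of `HermitianLatticesLocal`:
`localConjDatum_adicCompletion` — `σ_w` is an involution preserving the valuation, a uniformiser of `F` at `v` is a
`σ_w`-fixed uniformiser of `E_w`, `|2|_w = 1`, and `1`-units are squares (Hensel in the complete d.v.r. `𝒪_w`, tree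
`adicCompletionIntegers.henselianLocalRing`).  Hence (`HyperspecialUnitaryCartan.exists_cartan_antidiagonal`):

* `cartanAntidiag_adicCompletion` — **Cartan decomposition of the quasi-split unitary group
  `U(σ_w, J₀)(E_w)`, `J₀ = antidiag(1,…,1)`, relative to `U(σ_w, J₀) ∩ GL_N(𝒪_w)`**: every `g ∈ U(σ_w, J₀)` is
  `k₁⁻¹ diag(d) k₂⁻¹` with `k₁, k₂ ∈ U(σ_w, J₀) ∩ GL_N(𝒪_w)` and `σ_w`-fixed `d` — the statement of sub-stub (2b)
  `CartanAntidiag` of the line `b4-hyperspecial-gelfand-pair` (cell hodgecm-mathlib, rung-0 row IV-9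
  `HyperspecialGelfandPair`) VERBATIM (`cartanAntidiag`).

* `unramifiedLocalConjDatum_adicCompletion` — at EVERY unramified non-split place (dyadic ones included) `E_w` with
  `σ_w` carries the dyadic-capable datum `UnramifiedLocalConjDatum` of `HermitianLatticesLocal`: (trace) from the
  residue field (`UnitaryGroupInertPlaceHyperbolicBasisDyadic.exists_add_map_eq_one_integer`) and (norm) with level,
  «`N(U_w^n) = U_v^n`» (Serre V §2 Prop. 3 a)), from `UnramifiedQuadraticNorm.exists_mul_map_eq_of_sub_one_mem` in the
  complete discrete valuation ring `𝒪_w` for the ideal `𝔪_w^n` (`adicCompletionIntegers.isAdicComplete` and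
  `𝔪 ↦ 𝔪ⁿ`); hence
* `cartanAntidiag_of_isUnramifiedIn` — **the Cartan decomposition of `U(σ_w, J₀)(E_w)` at every unramified non-split
  place**, i.e. the statement `cartanAntidiag` with the binder `2 ∉ v` removed (Tits 3.3.3 has no restriction on the
  residue characteristic).

HC_CM is proved only modulo the 7 printed citations until rung 0 of that ladder closes; this file is unconditional.

References: J. Tits, *Reductive groups over local fields*, PSPUM 33.1 (1979), §3.3.3 [Tits1979];
F. Bruhat, J. Tits, Publ. IHÉS 41 (1972), §4.4 [BruhatTits1972]; O'Meara (1963) §63A (local squares) [Omeara1963];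
J.-P. Serre, *Local Fields*, GTM 67 (1979), Ch. II §1, Ch. V §2 Prop. 3 [Serre1979]; R. Jacobowitz, Amer. J. Math. 84
(1962), §7 [Jacobowitz1962].
-/

noncomputable section

open scoped Valued WithZero Matrix
open NumberField IsDedekindDomain Polynomial

namespace Literature.NumberTheory.Automorphic.UnitaryGroup

open Literature.NumberTheory.Automorphic.HermitianLattice

variable {F E : Type} [Field F] [NumberField F] [Field E] [NumberField E] [Algebra F E]

/-- **Hensel square roots in `E_w`**: for `v ∤ 2`… precisely, if `|2|_w = 1` then every `u ∈ E_w` with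
`|u - 1|_w < 1` is a square `s²` with `|s - 1|_w < 1` (Hensel's lemma for `X² - u` at `1` in the henselian ring
`𝒪_w`). [cite: Omeara1963, §63A (63:1)] -/
theorem exists_sq_eq_of_valued_sub_one_lt (w : HeightOneSpectrum (𝓞 E))
    (h2 : Valued.v (2 : w.adicCompletion E) = 1) (u : w.adicCompletion E) (hu : Valued.v (u - 1) < 1) :
    ∃ s : w.adicCompletion E, s ^ 2 = u ∧ Valued.v (s - 1) < 1 := by
  haveI : HenselianLocalRing 𝒪[w.adicCompletion E] :=
    inferInstanceAs (HenselianLocalRing (w.adicCompletionIntegers E))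
  have hint : (Valued.v (R := w.adicCompletion E)).Integers 𝒪[w.adicCompletion E] :=
    Valuation.integer.integers _
  have hvu : Valued.v u = 1 := by
    have : u = 1 + (u - 1) := by ring
    rw [this]; exact Valuation.map_one_add_of_lt _ hu
  have hu1 : u ∈ 𝒪[w.adicCompletion E] := (Valuation.mem_integer_iff _ _).2 hvu.le
  obtain ⟨u', hu'⟩ : ∃ u' : 𝒪[w.adicCompletion E], (u' : w.adicCompletion E) = u := ⟨⟨u, hu1⟩, rfl⟩
  have hmem : ∀ x : 𝒪[w.adicCompletion E], x ∈ IsLocalRing.maximalIdeal 𝒪[w.adicCompletion E] ↔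
      Valued.v (x : w.adicCompletion E) < 1 := by
    intro x
    rw [IsLocalRing.mem_maximalIdeal, mem_nonunits_iff, hint.isUnit_iff_valuation_eq_one]
    exact ⟨fun h => lt_of_le_of_ne x.2 h, fun h => ne_of_lt h⟩
  have he1 : (X ^ 2 - C u').eval 1 = 1 - u' := by
    rw [eval_sub, eval_pow, eval_X, eval_C, one_pow]
  have he2 : (derivative (X ^ 2 - C u')).eval 1 = 2 := by
    rw [derivative_sub, derivative_C, sub_zero, derivative_X_pow, eval_mul, eval_C, eval_pow, eval_X, one_pow,
      mul_one]
    norm_num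
  have h1 : (X ^ 2 - C u').eval 1 ∈ IsLocalRing.maximalIdeal 𝒪[w.adicCompletion E] := by
    rw [he1, hmem, AddSubgroupClass.coe_sub, OneMemClass.coe_one, hu', ← Valuation.map_neg, neg_sub]
    exact hu
  have h2' : IsUnit ((derivative (X ^ 2 - C u')).eval 1) := by
    rw [he2, hint.isUnit_iff_valuation_eq_one]
    exact h2
  obtain ⟨a, ha, ha1⟩ :=
    HenselianLocalRing.is_henselian (X ^ 2 - C u') (monic_X_pow_sub_C u' two_ne_zero) 1 h1 h2'
  refine ⟨(a : w.adicCompletion E), ?_, ?_⟩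
  · have h : a ^ 2 = u' := by
      rwa [IsRoot.def, eval_sub, eval_pow, eval_X, eval_C, sub_eq_zero] at ha
    rw [← hu', ← h, SubmonoidClass.coe_pow]
  · have := (hmem _).1 ha1
    rwa [AddSubgroupClass.coe_sub, OneMemClass.coe_one] at this

/-- **The local conjugation datum at an unramified, non-dyadic, non-split place.**  For `c ≠ 1`, `w ∣ v` with
`c • w = w`, `v` unramified in `E` and `v ∤ 2`: `σ_w = galAdicCompletionMap c hw` is an involution of `E_w`
preserving the valuation, the image of a uniformiser of `F` at `v` is a `σ_w`-fixed uniformiser of `E_w`,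
`|2|_w = 1`, and `1`-units of `E_w` are squares. [cite: Tits1979, §3.3.3] -/
theorem localConjDatum_adicCompletion [Algebra.IsQuadraticExtension F E] (c : E ≃ₐ[F] E) (hc1 : c ≠ 1)
    (v : HeightOneSpectrum (𝓞 F)) (w : PlacesOver E v) (hw : c • w.1 = w.1)
    (hv : Algebra.IsUnramifiedIn (𝓞 E) v.asIdeal) (h2 : (2 : 𝓞 F) ∉ v.asIdeal) :
    ∃ ϖ : w.1.adicCompletion E, LocalConjDatum (galAdicCompletionMap (L := E) c hw) ϖ := by
  obtain ⟨π, hπ⟩ := IsDedekindDomain.HeightOneSpectrum.valuation_exists_uniformizer F v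
  have hval : ∀ y : v.adicCompletion F, Valued.v (toPlace v w y) = Valued.v y :=
    Liu2021.LemD1IndexedNonVacuityInertCofinite.valued_toPlace_of_isUnramifiedIn E v hv w
  have h2w : Valued.v (2 : w.1.adicCompletion E) = 1 := by
    have h2F : Valued.v (2 : v.adicCompletion F) = 1 := by
      have e1 : (algebraMap F (v.adicCompletion F)) (algebraMap (𝓞 F) F 2) = 2 := by rw [map_ofNat, map_ofNat]
      rw [← e1]
      change Valued.v ((algebraMap (𝓞 F) F 2 : F) : v.adicCompletion F) = 1
      rw [HeightOneSpectrum.valuedAdicCompletion_eq_valuation', HeightOneSpectrum.valuation_of_algebraMap]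
      exact HeightOneSpectrum.intValuation_eq_one_iff.2 h2
    rw [← map_ofNat (toPlace v w) 2, hval, h2F]
  refine ⟨((algebraMap F E π : E) : w.1.adicCompletion E), ⟨?_, ?_, ?_, ?_, h2w, ?_⟩⟩
  · intro x
    rw [galAdicCompletionMap_galAdicCompletionMap (L := E) c c hw hw x,
      galAdicCompletionMap_congr_left (L := E) (algEquiv_mul_self_eq_one F hc1) _ (one_smul _ w.1) x,
      galAdicCompletionMap_one]
  · intro x
    exact valued_galAdicCompletionMap (L := E) c hw x
  · exact galAdicCompletionMap_algebraMap (F := F) c hw π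
  · rw [← toPlace_coe v w π, hval, HeightOneSpectrum.valuedAdicCompletion_eq_valuation', hπ]
  · exact exists_sq_eq_of_valued_sub_one_lt w.1 h2w

/-- **Cartan decomposition of `U(σ_w, J₀)(E_w)` at a non-split unramified non-dyadic place** — the statement of
sub-stub (2b) `CartanAntidiag` (line `b4-hyperspecial-gelfand-pair`, row IV-9) verbatim: for
`g ∈ U(σ_w, J₀)(E_w)` there are `k₁, k₂ ∈ U(σ_w, J₀) ∩ GL_N(𝒪_w)` and a `σ_w`-fixed `d` with `k₁ g k₂ = diag(d)`.
[cite: Tits1979, §3.3.3] -/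
theorem cartanAntidiag :
    ∀ (F E : Type) [Field F] [NumberField F] [Field E] [NumberField E] [Algebra F E]
      [Algebra.IsQuadraticExtension F E] (c : E ≃ₐ[F] E) (_hc1 : c ≠ 1) (N : ℕ)
      (v : HeightOneSpectrum (𝓞 F)) (w : UnitaryGroup.PlacesOver E v) (hw : c • w.1 = w.1)
      (_hv : Algebra.IsUnramifiedIn (𝓞 E) v.asIdeal) (_h2 : (2 : 𝓞 F) ∉ v.asIdeal),
      ∀ g : GL (Fin N) (w.1.adicCompletion E),
        g ∈ unitaryGroupOfForm (galAdicCompletionMap (L := E) c hw)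
            ((StdForm.antidiagonal N).over (w.1.adicCompletion E)) →
          ∃ k₁ k₂ : GL (Fin N) (w.1.adicCompletion E),
            k₁ ∈ unitaryGroupOfForm (galAdicCompletionMap (L := E) c hw)
                ((StdForm.antidiagonal N).over (w.1.adicCompletion E)) ∧
            k₁ ∈ glInt N (w.1.adicCompletion E) ∧
            k₂ ∈ unitaryGroupOfForm (galAdicCompletionMap (L := E) c hw)
                ((StdForm.antidiagonal N).over (w.1.adicCompletion E)) ∧
            k₂ ∈ glInt N (w.1.adicCompletion E) ∧
            ∃ d : Fin N → w.1.adicCompletion E,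
              ((k₁ * g * k₂ : GL (Fin N) (w.1.adicCompletion E)) : Matrix (Fin N) (Fin N) (w.1.adicCompletion E)) =
                  Matrix.diagonal d ∧
                ∀ i, galAdicCompletionMap (L := E) c hw (d i) = d i := by
  intro F E _ _ _ _ _ _ c hc1 N v w hw hv h2 g hg
  obtain ⟨ϖ, hd⟩ := localConjDatum_adicCompletion c hc1 v w hw hv h2
  obtain ⟨k₁, k₂, hk₁U, hk₁i, hk₁i', hk₂U, hk₂i, hk₂i', d, hdiag, hdσ, -⟩ := exists_cartan_antidiagonal hd g hg
  have hglInt : ∀ k : GL (Fin N) (w.1.adicCompletion E),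
      (∀ i j, Valued.v ((k : Matrix (Fin N) (Fin N) (w.1.adicCompletion E)) i j) ≤ 1) →
      (∀ i j, Valued.v (((k⁻¹ : GL (Fin N) (w.1.adicCompletion E)) :
        Matrix (Fin N) (Fin N) (w.1.adicCompletion E)) i j) ≤ 1) → k ∈ glInt N (w.1.adicCompletion E) := by
    intro k hk hk'
    rw [mem_glInt_adicCompletion_iff]
    exact ⟨fun i j => (HeightOneSpectrum.mem_adicCompletionIntegers _ _ _).2 (hk i j),
      fun i j => (HeightOneSpectrum.mem_adicCompletionIntegers _ _ _).2 (hk' i j)⟩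
  exact ⟨k₁, k₂, hk₁U, hglInt k₁ hk₁i hk₁i', hk₂U, hglInt k₂ hk₂i hk₂i', d, hdiag, hdσ⟩


/-! ## Dyadic places included: the unramified datum, and the Cartan decomposition, at every unramified non-split place -/

/-- Change of the ideal of definition `I ↦ I ^ k` (`k ≥ 1`, same adic topology): an `I`-adically complete ring is
`I ^ k`-adically complete — an `(I^k)`-Cauchy sequence is `I`-Cauchy, and its `I`-limit is an `(I^k)`-limit along the
subsequence `n ↦ k n`.  (The tree's `Resolution/CompleteLocalDomainNormalizationPowerSeries.isAdicComplete_of_pow_le_of_le`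
is the general sandwich `Iᵉ ≤ J ≤ I`; it is not imported here to keep the automorphic cone light.)
[cite: Serre1979, Ch. II §1] -/
private theorem isAdicComplete_pow {R : Type*} [CommRing R] (I : Ideal R) [IsAdicComplete I R] {k : ℕ} (hk : 0 < k) :
    IsAdicComplete (I ^ k) R where
  haus' := by
    intro x hx
    refine IsHausdorff.haus' (I := I) x fun n => (hx n).mono (Submodule.smul_mono_left ?_)
    rw [← pow_mul]
    exact Ideal.pow_le_pow_right (Nat.le_mul_of_pos_left n hk)
  prec' := by
    intro f hf
    have hf' : ∀ {m n}, m ≤ n → f m ≡ f n [SMOD (I ^ m • ⊤ : Submodule R R)] := fun {m n} hmn =>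
      (hf hmn).mono (Submodule.smul_mono_left (by
        rw [← pow_mul]
        exact Ideal.pow_le_pow_right (Nat.le_mul_of_pos_left m hk)))
    obtain ⟨L, hL⟩ := IsPrecomplete.prec' (I := I) f hf'
    refine ⟨L, fun n => ?_⟩
    have h1 : f n ≡ f (k * n) [SMOD ((I ^ k) ^ n • ⊤ : Submodule R R)] := hf (Nat.le_mul_of_pos_left n hk)
    have h2 : f (k * n) ≡ L [SMOD ((I ^ k) ^ n • ⊤ : Submodule R R)] := by
      rw [← pow_mul]
      exact hL (k * n)
    exact h1.trans h2

/-- **The unramified local conjugation datum at every unramified non-split place, dyadic places included.**  For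
`c ≠ 1`, `w ∣ v` with `c • w = w` and `v` unramified in `E`: `σ_w = galAdicCompletionMap c hw` is an involution of
`E_w` preserving the valuation, the image of a uniformiser of `F` at `v` is a `σ_w`-fixed uniformiser of `E_w`,
(trace) `t + σ_w t = 1` for some `t ∈ 𝒪_w` — from the residue field, where `c` acts non-trivially — and (norm)
«`N(U_w^n) = U_v^n` for all `n ≥ 1`»: a `σ_w`-fixed `u` with `|u − 1|_w < 1` is `z σ_w(z)` with
`|z − 1|_w ≤ |u − 1|_w` — the norm equation solved in the complete discrete valuation ring `𝒪_w` modulo the ideal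
`𝔪_w^n`, `|u − 1|_w = |ϖ_w|^n`. No condition on the residue characteristic.
[cite: Serre1979, Ch. V §2 Prop. 3; Tits1979, §3.3.3] -/
theorem unramifiedLocalConjDatum_adicCompletion [Algebra.IsQuadraticExtension F E] (c : E ≃ₐ[F] E) (hc1 : c ≠ 1)
    (v : HeightOneSpectrum (𝓞 F)) (w : PlacesOver E v) (hw : c • w.1 = w.1)
    (hv : Algebra.IsUnramifiedIn (𝓞 E) v.asIdeal) :
    ∃ ϖ : w.1.adicCompletion E, UnramifiedLocalConjDatum (galAdicCompletionMap (L := E) c hw) ϖ := by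
  obtain ⟨π, hπ⟩ := IsDedekindDomain.HeightOneSpectrum.valuation_exists_uniformizer F v
  have hval : ∀ y : v.adicCompletion F, Valued.v (toPlace v w y) = Valued.v y :=
    Liu2021.LemD1IndexedNonVacuityInertCofinite.valued_toPlace_of_isUnramifiedIn E v hv w
  have hσσ : ∀ x, galAdicCompletionMap (L := E) c hw (galAdicCompletionMap (L := E) c hw x) = x :=
    galAdicCompletionMap_galAdicCompletionMap_of_smul_eq c w hc1 hw
  have hvσ : ∀ x, Valued.v (galAdicCompletionMap (L := E) c hw x) = Valued.v x :=
    fun x => valued_galAdicCompletionMap (L := E) c hw x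
  -- (trace), from the residue field, in the `ValuativeRel` integers of `E_w`, then read in `E_w`
  have htrace : ∃ t : w.1.adicCompletion E, Valued.v t ≤ 1 ∧ t + galAdicCompletionMap (L := E) c hw t = 1 := by
    have hmem : ∀ x ∈ (ValuativeRel.valuation (w.1.adicCompletion E)).integer,
        galAdicCompletionMap (L := E) c hw x ∈ (ValuativeRel.valuation (w.1.adicCompletion E)).integer :=
      fun x hx => galAdicCompletionMap_mem_integer c w hw hx
    let σO := (galAdicCompletionMap (L := E) c hw).restrict _ _ hmem
    obtain ⟨b, hb⟩ := exists_add_map_eq_one_integer c w hc1 hw hv σO (fun _ => rfl) fun x => Subtype.ext (hσσ x)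
    refine ⟨b, ?_, ?_⟩
    · have h := b.2
      rw [mem_integer_iff_mem_adicCompletionIntegers, HeightOneSpectrum.mem_adicCompletionIntegers] at h
      exact h
    · have h := congrArg Subtype.val hb
      exact h
  -- (norm) with level, in the complete discrete valuation ring `R = 𝒪_w`
  have hnorm : ∀ u : w.1.adicCompletion E, galAdicCompletionMap (L := E) c hw u = u → Valued.v (u - 1) < 1 →
      ∃ z : w.1.adicCompletion E, z * galAdicCompletionMap (L := E) c hw z = u ∧ Valued.v (z - 1) ≤ Valued.v (u - 1) := by
    intro u hσu hu1
    by_cases hu : u = 1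
    · exact ⟨1, by rw [hu, map_one, mul_one], by rw [hu, sub_self]⟩
    have hint : Valued.v.Integers (w.1.adicCompletionIntegers E) := Valuation.valuationSubring.integers _
    have hmemR : ∀ x ∈ w.1.adicCompletionIntegers E,
        galAdicCompletionMap (L := E) c hw x ∈ w.1.adicCompletionIntegers E :=
      fun x hx => (galAdicCompletionMap_mem_adicCompletionIntegers_iff E c hw x).2 hx
    let σR : w.1.adicCompletionIntegers E →+* w.1.adicCompletionIntegers E :=
      (galAdicCompletionMap (L := E) c hw).restrict _ _ hmemR
    have hσR : ∀ x : w.1.adicCompletionIntegers E, ((σR x : w.1.adicCompletionIntegers E) : w.1.adicCompletion E) =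
        galAdicCompletionMap (L := E) c hw x := fun _ => rfl
    have hσσR : ∀ x, σR (σR x) = x := fun x => Subtype.ext (hσσ x)
    -- the trace element in `R`
    obtain ⟨t, ht1, htt⟩ := htrace
    let tR : w.1.adicCompletionIntegers E := ⟨t, (HeightOneSpectrum.mem_adicCompletionIntegers _ _ _).2 ht1⟩
    have httR : tR + σR tR = 1 := Subtype.ext htt
    -- `u ∈ R`, `u - 1 = e ϖ^k` with `k ≥ 1`
    have hvu : Valued.v u = 1 := by
      have e : u = 1 + (u - 1) := by ring
      rw [e]
      exact Valuation.map_one_add_of_lt _ hu1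
    let uR : w.1.adicCompletionIntegers E := ⟨u, (HeightOneSpectrum.mem_adicCompletionIntegers _ _ _).2 hvu.le⟩
    have hσuR : σR uR = uR := Subtype.ext hσu
    obtain ⟨ϖ, hϖ⟩ := IsDiscreteValuationRing.exists_irreducible (w.1.adicCompletionIntegers E)
    have hx0 : uR - 1 ≠ 0 := fun h0 => hu (sub_eq_zero.1 (by
      have h := congrArg Subtype.val h0
      exact h))
    obtain ⟨k, e, hk⟩ := IsDiscreteValuationRing.eq_unit_mul_pow_irreducible hx0 hϖ
    have hve : Valued.v ((e : w.1.adicCompletionIntegers E) : w.1.adicCompletion E) = 1 :=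
      hint.isUnit_iff_valuation_eq_one.1 e.isUnit
    have hvuk : Valued.v (u - 1) = Valued.v (((ϖ : w.1.adicCompletionIntegers E) : w.1.adicCompletion E) ^ k) := by
      have h := congrArg (fun x : w.1.adicCompletionIntegers E => Valued.v (x : w.1.adicCompletion E)) hk
      push_cast at h
      rw [map_mul, hve, one_mul] at h
      exact h
    have hkpos : 0 < k := by
      rcases Nat.eq_zero_or_pos k with h0 | h0
      · exfalso
        rw [h0, pow_zero] at hvuk
        rw [hvuk, map_one] at hu1
        exact lt_irrefl _ hu1
      · exact h0
    -- the ideal `𝔪^k`: complete, `σ`-stable, contains `u - 1`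
    haveI : IsAdicComplete (IsLocalRing.maximalIdeal (w.1.adicCompletionIntegers E) ^ k) (w.1.adicCompletionIntegers E) :=
      isAdicComplete_pow _ hkpos
    have hσI : ∀ a ∈ IsLocalRing.maximalIdeal (w.1.adicCompletionIntegers E) ^ k,
        σR a ∈ IsLocalRing.maximalIdeal (w.1.adicCompletionIntegers E) ^ k := by
      intro a ha
      have h1 : Ideal.map σR (IsLocalRing.maximalIdeal _) ≤ IsLocalRing.maximalIdeal (w.1.adicCompletionIntegers E) := by
        rw [Ideal.map_le_iff_le_comap]
        intro x hx
        exact Literature.NumberTheory.LocalFields.UnramifiedQuadraticNorm.map_mem_maximalIdeal σR hσσR x hx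
      have h2 : Ideal.map σR (IsLocalRing.maximalIdeal _ ^ k) ≤ IsLocalRing.maximalIdeal (w.1.adicCompletionIntegers E) ^ k := by
        rw [Ideal.map_pow]
        exact Ideal.pow_right_mono h1 k
      exact h2 (Ideal.mem_map_of_mem σR ha)
    have hu1R : uR - 1 ∈ IsLocalRing.maximalIdeal (w.1.adicCompletionIntegers E) ^ k := by
      rw [hk]
      exact Ideal.mul_mem_left _ _ (Ideal.pow_mem_pow (hϖ.maximalIdeal_eq ▸ Ideal.mem_span_singleton_self ϖ) k)
    obtain ⟨s, hs, hs1⟩ :=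
      Literature.NumberTheory.LocalFields.UnramifiedQuadraticNorm.exists_mul_map_eq_of_sub_one_mem σR hσσR hσI httR
        hσuR hu1R
    refine ⟨s, ?_, ?_⟩
    · have h := congrArg Subtype.val hs
      exact h
    · rw [hvuk]
      exact (HeightOneSpectrum.adicCompletionIntegers.mem_maximalIdeal_pow_iff E w.1 hϖ k (s - 1)).1 hs1
  refine ⟨((algebraMap F E π : E) : w.1.adicCompletion E), ⟨hσσ, hvσ, ?_, ?_, htrace, hnorm⟩⟩
  · exact galAdicCompletionMap_algebraMap (F := F) c hw π
  · rw [← toPlace_coe v w π, hval, HeightOneSpectrum.valuedAdicCompletion_eq_valuation', hπ]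

/-- **Cartan decomposition of `U(σ_w, J₀)(E_w)` at EVERY non-split unramified place — the statement `cartanAntidiag`
of sub-stub (2b) `CartanAntidiag` (line `b4-hyperspecial-gelfand-pair`, row IV-9) with the binder `2 ∉ v` removed**: for
`g ∈ U(σ_w, J₀)(E_w)` there are `k₁, k₂ ∈ U(σ_w, J₀) ∩ GL_N(𝒪_w)` and a `σ_w`-fixed `d` with `k₁ g k₂ = diag(d)`.
(`UnramifiedLocalConjDatum.exists_cartan_antidiagonal` with the datum `unramifiedLocalConjDatum_adicCompletion`.)
[cite: Tits1979, §3.3.3] -/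
theorem cartanAntidiag_of_isUnramifiedIn :
    ∀ (F E : Type) [Field F] [NumberField F] [Field E] [NumberField E] [Algebra F E]
      [Algebra.IsQuadraticExtension F E] (c : E ≃ₐ[F] E) (_hc1 : c ≠ 1) (N : ℕ)
      (v : HeightOneSpectrum (𝓞 F)) (w : UnitaryGroup.PlacesOver E v) (hw : c • w.1 = w.1)
      (_hv : Algebra.IsUnramifiedIn (𝓞 E) v.asIdeal),
      ∀ g : GL (Fin N) (w.1.adicCompletion E),
        g ∈ unitaryGroupOfForm (galAdicCompletionMap (L := E) c hw)
            ((StdForm.antidiagonal N).over (w.1.adicCompletion E)) →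
          ∃ k₁ k₂ : GL (Fin N) (w.1.adicCompletion E),
            k₁ ∈ unitaryGroupOfForm (galAdicCompletionMap (L := E) c hw)
                ((StdForm.antidiagonal N).over (w.1.adicCompletion E)) ∧
            k₁ ∈ glInt N (w.1.adicCompletion E) ∧
            k₂ ∈ unitaryGroupOfForm (galAdicCompletionMap (L := E) c hw)
                ((StdForm.antidiagonal N).over (w.1.adicCompletion E)) ∧
            k₂ ∈ glInt N (w.1.adicCompletion E) ∧
            ∃ d : Fin N → w.1.adicCompletion E,
              ((k₁ * g * k₂ : GL (Fin N) (w.1.adicCompletion E)) : Matrix (Fin N) (Fin N) (w.1.adicCompletion E)) =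
                  Matrix.diagonal d ∧
                ∀ i, galAdicCompletionMap (L := E) c hw (d i) = d i := by
  intro F E _ _ _ _ _ _ c hc1 N v w hw hv g hg
  obtain ⟨ϖ, hd⟩ := unramifiedLocalConjDatum_adicCompletion c hc1 v w hw hv
  obtain ⟨k₁, k₂, hk₁U, hk₁i, hk₁i', hk₂U, hk₂i, hk₂i', d, hdiag, hdσ, -⟩ := hd.exists_cartan_antidiagonal g hg
  have hglInt : ∀ k : GL (Fin N) (w.1.adicCompletion E),
      (∀ i j, Valued.v ((k : Matrix (Fin N) (Fin N) (w.1.adicCompletion E)) i j) ≤ 1) →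
      (∀ i j, Valued.v (((k⁻¹ : GL (Fin N) (w.1.adicCompletion E)) :
        Matrix (Fin N) (Fin N) (w.1.adicCompletion E)) i j) ≤ 1) → k ∈ glInt N (w.1.adicCompletion E) := by
    intro k hk hk'
    rw [mem_glInt_adicCompletion_iff]
    exact ⟨fun i j => (HeightOneSpectrum.mem_adicCompletionIntegers _ _ _).2 (hk i j),
      fun i j => (HeightOneSpectrum.mem_adicCompletionIntegers _ _ _).2 (hk' i j)⟩
  exact ⟨k₁, k₂, hk₁U, hglInt k₁ hk₁i hk₁i', hk₂U, hglInt k₂ hk₂i hk₂i', d, hdiag, hdσ⟩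

end Literature.NumberTheory.Automorphic.UnitaryGroup

end
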